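import Summits.AtomisticToContinuum.HydrodynamicLimit.Theorems.OneFlightGossipEngineEnergyCurrentTailsLossIntensityFloorMixingGlue
import HarnessLib

/-!
# The loss-intensity floor LIF₄″ from the thermal quartic mixing floor QMF₄ and the flux ceiling
# (stub `stub_lossIntensityFloor4_of_mixingFlux4`, line `quartic-schur-ledger`, crux
# `EnergyCurrentTails`, stmt-AtomisticToContinuum-9235)

Registered glue stub `QMF₄ → S2a″ → LIF₄` of the lead's skeleton
`Cruxes/EnergyCurrentTails/Lines/quartic_schur_ledger.lean` (seat c5, cycle 3): the landed LIF″
(`stub_lossIntensityFloor_of_mixingFlux`, module `…LossIntensityFloorMixingGlue`) with the cut-off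
FIFTH velocity moment replaced by the cut-off FOURTH moment `M₄^{>K₀} = (N+1)⁻¹Σᵢ 𝟙{K₀<‖vᵢ‖}‖vᵢ‖⁴`
in the left-hand integrand of both the lower primitive (now QMF₄, thermal rate
`ofReal(cν)·∫_s^t M₄^{>K₀} ≤ E[Σ_{coll∈(s,t]} Σ_{ordered contact pairs} 𝟙{K₀<‖v₁⁻‖}(N+1)⁻¹·2‖v₁⁺‖²‖v₂⁺‖²]`)
and the conclusion, and with `K₀ ≥ 0` (the cut-off of QMF₄ is kept, no raising).  The moment integrand
is only carried through: per ORDERED collision record (`pre = ‖v₁⁻‖⁴+‖v₂⁻‖⁴`, `post = ‖v₁⁺‖⁴+‖v₂⁺‖⁴`,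
`mix± = ‖v₁±‖²‖v₂±‖²`; pair energy conservation `E² = pre + 2mix⁻ = post + 2mix⁺`):
`2mix⁺ = (pre − post) + 2mix⁻ ≤ 2(pre−post)₊/2 + 2mix⁻` (`c5lif_ofReal_mixpostSum_le`).
Proof, in `ℝ≥0∞`: (1) `I′ = I` (same cut-off); (2) QMF₄, whose `∑ᶠ` right side is `ofReal` of the
real collision sum of `𝟙{K₀<‖preVel.1‖}(N+1)⁻¹·2‖postVel.1‖²‖postVel.2‖²` on the conull good set
(LIF″'s bridge `c5lif2_bridge_mixpost_cutoff`: `c5lif_ofReal_collisionSum_eq_finsum` with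
`ofConfig_preVel_eq_collidePair` and `ofConfig_postVel`); (3) drop the cut-off record by record
(LIF″'s `c5lif2_cutoffMixSum_le_mixSum`); (4) the one-sided Povzner identity summed and integrated,
the one splitting of an integral of a sum using the a.e.-measurability of the flux integrand
(`c5lif_aemeasurable_fluxSum`); (5) S2a″ on the window; (6) the arithmetic `c5lif_assembly` (`δ = 1`):
`(c/2)ν∫M₄^{>K₀} ≤ Loss + Cν(s′−s)·sup m₂·sup m₃`.
Constants: `σ₀ = min(σ₁, σ₃, 1/2)`, `δ_LIF = c/2`, `K₀ = K₀^{QMF₄}`, `C_LIF = C`, `N₀ = max N₁ N₃`.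
References: Bobylev 1997; Mischler–Wennberg 1999 (Povzner with exact energy-split variables);
Cercignani–Illner–Pulvirenti 1994 §4.2, App. 4.A.
-/

noncomputable section

open MeasureTheory Set Filter
open scoped ENNReal InnerProductSpace

namespace Summit.AtomisticToContinuum.HydrodynamicLimit.Theorems.QuarticSchurLedger

open Literature.MathematicalPhysics.KineticTheory Literature.Analysis.FluidPDE

/-- **Stub LIF₄″ — THE QUARTIC LOSS-INTENSITY FLOOR FROM THE THERMAL MIXING FLOOR QMF₄ AND THE FLUX
CEILING** (registered glue stub of the line `quartic-schur-ledger`, crux stmt-AtomisticToContinuum-9235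
`EnergyCurrentTails`; seat c5 cycle 3): `QMF₄ → S2a″ → LIF₄` — for every horizon `T > 0` and flow
family there are `δ > 0`, `K₀ ≥ 0`, `C ≥ 0`, `N₀` with, for `N ≥ N₀` and `0 ≤ s ≤ s′ ≤ T`,
`δ ν_N ∫_s^{s′} M₄^{>K₀}(r) dr ≤ Loss_N(s,s′] + C ν_N (s′−s) · sup m₂ · sup m₃` (see the module
doc-string for the proof; `δ_LIF = c_QMF₄/2`, `K₀ = K₀^{QMF₄}`, `C = C_{S2a″}`). [folklore] -/
theorem stub_lossIntensityFloor4_of_mixingFlux4 :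
    (∀ (a₀ θ₀ : T3 → ℝ) (u₀ : T3 → V3), Continuous a₀ → Continuous θ₀ → Continuous u₀ → (∀ x, 0 < a₀ x) →
    (∀ x, 0 < θ₀ x) → ∃ σ₀ : ℝ, 0 < σ₀ ∧ ∀ σ, 0 < σ → σ < σ₀ → ∀ T, 0 < T → ∀ Φ : (N : ℕ) → HardSphereFlow
    (Torus.geometry (Fin 3)) (hsDiameter σ N) (N+1), ∃ K₀, 0 ≤ K₀ ∧ ∃ c, 0 < c ∧ ∃ N₀, ∀ N, N₀ ≤ N → ∀ s
    t, 0 ≤ s → s ≤ t → t ≤ T → ENNReal.ofReal (c*(σ^2*((N+1 : ℕ) : ℝ)^((1 : ℝ)/3)))*∫⁻ τ in Ioc s t, (∫⁻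
    z, ENNReal.ofReal (((N+1 : ℕ) : ℝ)⁻¹*∑ i, if K₀ < ‖((Φ N).flow τ z i).2‖ then ‖((Φ N).flow τ z i).2‖^4
    else 0) ∂localGibbsLaw σ a₀ u₀ θ₀ N (Φ N)) ≤ ∫⁻ z, (∑ᶠ τ ∈ collisionTimes (Torus.geometry (Fin 3))
    (hsDiameter σ N) ((Φ N).flow · z) ∩ Ioc s t, ∑ i, ∑ j, if i = j then 0 else (contactSet
    (Torus.geometry (Fin 3)) _ (hsDiameter σ N) i j).indicator (fun y => if K₀ < ‖(collidePair
    (Torus.geometry (Fin 3)) i j y i).2‖ then ENNReal.ofReal (((N+1 : ℕ) : ℝ)⁻¹*(2*(‖(y i).2‖^2*‖(y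
    j).2‖^2))) else 0) ((Φ N).flow τ z)) ∂localGibbsLaw σ a₀ u₀ θ₀ N (Φ N)) → (∀ (a₀ θ₀ : T3 → ℝ) (u₀ : T3
    → V3), Continuous a₀ → Continuous θ₀ → Continuous u₀ → (∀ x, 0 < a₀ x) → (∀ x, 0 < θ₀ x) → ∃ σ₀ : ℝ, 0
    < σ₀ ∧ ∀ σ, 0 < σ → σ < σ₀ → ∀ T, 0 < T → ∀ Φ : (N : ℕ) → HardSphereFlow (Torus.geometry (Fin 3))
    (hsDiameter σ N) (N+1), ∃ C, 0 ≤ C ∧ ∃ N₀, ∀ N : ℕ, N₀ ≤ N → ∀ s s', 0 ≤ s → s ≤ s' → s' ≤ T → (∫⁻ z,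
    ENNReal.ofReal (((N : ℝ)+1)⁻¹*(Φ N).collisionSum (Ioc s s') (fun col =>
    ‖col.preVel.1‖^2*‖col.preVel.2‖^2) z) ∂localGibbsLaw σ a₀ u₀ θ₀ N (Φ N)) ≤ ENNReal.ofReal (C*(σ^2*((N
    : ℝ)+1)^(1/3 : ℝ)*(s' - s)))*(⨆ r ∈ Icc s s', (∫⁻ z, ENNReal.ofReal (((N : ℝ)+1)⁻¹*∑ i, ‖((Φ N).flow r
    z i).2‖^2) ∂localGibbsLaw σ a₀ u₀ θ₀ N (Φ N)))*(⨆ r ∈ Icc s s', (∫⁻ z, ENNReal.ofReal (((N : ℝ)+1)⁻¹*∑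
    i, ‖((Φ N).flow r z i).2‖^3) ∂localGibbsLaw σ a₀ u₀ θ₀ N (Φ N)))) → ∀ (a₀ θ₀ : T3 → ℝ) (u₀ : T3 → V3),
    Continuous a₀ → Continuous θ₀ → Continuous u₀ → (∀ x, 0 < a₀ x) → (∀ x, 0 < θ₀ x) → ∃ σ₀ : ℝ, 0 < σ₀ ∧
    ∀ σ, 0 < σ → σ < σ₀ → ∀ T, 0 < T → ∀ Φ : (N : ℕ) → HardSphereFlow (Torus.geometry (Fin 3)) (hsDiameter
    σ N) (N+1), ∃ δ, 0 < δ ∧ ∃ K₀, 0 ≤ K₀ ∧ ∃ C, 0 ≤ C ∧ ∃ N₀, ∀ N : ℕ, N₀ ≤ N → ∀ s s', 0 ≤ s → s ≤ s' →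
    s' ≤ T → ENNReal.ofReal (δ*(σ^2*((N : ℝ)+1)^(1/3 : ℝ)))*(∫⁻ r in Ioc s s', (∫⁻ z, ENNReal.ofReal (((N
    : ℝ)+1)⁻¹*∑ i, (if K₀ < ‖((Φ N).flow r z i).2‖ then ‖((Φ N).flow r z i).2‖^4 else 0)) ∂localGibbsLaw σ
    a₀ u₀ θ₀ N (Φ N))) ≤ (∫⁻ z, ENNReal.ofReal (((N : ℝ)+1)⁻¹*(Φ N).collisionSum (Ioc s s') (fun col =>
    max (‖col.preVel.1‖^4 + ‖col.preVel.2‖^4 - ‖col.postVel.1‖^4 - ‖col.postVel.2‖^4) 0 / 2) z)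
    ∂localGibbsLaw σ a₀ u₀ θ₀ N (Φ N)) + ENNReal.ofReal (C*(σ^2*((N : ℝ)+1)^(1/3 : ℝ)*(s' - s)))*(⨆ r ∈
    Icc s s', (∫⁻ z, ENNReal.ofReal (((N : ℝ)+1)⁻¹*∑ i, ‖((Φ N).flow r z i).2‖^2) ∂localGibbsLaw σ a₀ u₀
    θ₀ N (Φ N)))*(⨆ r ∈ Icc s s', (∫⁻ z, ENNReal.ofReal (((N : ℝ)+1)⁻¹*∑ i, ‖((Φ N).flow r z i).2‖^3)
    ∂localGibbsLaw σ a₀ u₀ θ₀ N (Φ N))) := by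
  intro hQM hFX a₀ θ₀ u₀ ha hθ hu ha0 hθ0
  obtain ⟨σ₁, hσ₁, H1⟩ := hQM a₀ θ₀ u₀ ha hθ hu ha0 hθ0
  obtain ⟨σ₃, hσ₃, H3⟩ := hFX a₀ θ₀ u₀ ha hθ hu ha0 hθ0
  refine ⟨min σ₁ (min σ₃ (1 / 2)), by positivity, ?_⟩
  intro σ hσ hσ0 T hT Φ
  obtain ⟨hσ₁', hσ₃', hσh⟩ : σ < σ₁ ∧ σ < σ₃ ∧ σ < 1 / 2 := by
    simpa only [lt_min_iff] using hσ0
  obtain ⟨K₀, hK₀, c, hc, N₁, HR⟩ := H1 σ hσ hσ₁' T hT Φ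
  obtain ⟨C, hC, N₃, HF⟩ := H3 σ hσ hσ₃' T hT Φ
  refine ⟨c / 2, by positivity, K₀, hK₀, C, hC, max N₁ N₃, ?_⟩
  intro N hN s s' hs hss' hs'T
  have key₁ := HR N ((le_max_left _ _).trans hN) s s' hs hss' hs'T
  have key₃ := HF N ((le_max_right _ _).trans hN) s s' hs hss' hs'T
  have hcast : ((N + 1 : ℕ) : ℝ) = (N : ℝ) + 1 := by push_cast; ring
  rw [hcast] at key₁
  set μ : Measure (Config (N + 1) (Fin 3) T3) := localGibbsLaw σ a₀ u₀ θ₀ N (Φ N)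
  have hgood : ∀ᵐ z ∂μ, z ∈ (Φ N).good := ae_mem_good_localGibbsLaw σ a₀ u₀ θ₀ N (Φ N)
  have hε : hsDiameter σ N < 2⁻¹ := (hsDiameter_le hσ.le N).trans_lt (by rw [inv_eq_one_div]; exact hσh)
  have hc' : (0 : ℝ) ≤ ((N : ℝ) + 1)⁻¹ := by positivity
  -- (1) the cut-off of QMF₄ is kept: `I′ = I`
  have h5 : (∫⁻ r in Set.Ioc s s', (∫⁻ z, ENNReal.ofReal (((N : ℝ) + 1)⁻¹ *
        ∑ i : Fin (N + 1), (if K₀ < ‖((Φ N).flow r z i).2‖ then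
          ‖((Φ N).flow r z i).2‖ ^ 4 else 0)) ∂μ)) ≤
      ∫⁻ τ in Set.Ioc s s', (∫⁻ z, ENNReal.ofReal (((N : ℝ) + 1)⁻¹ *
        ∑ i : Fin (N + 1), if K₀ < ‖(((Φ N).flow τ z) i).2‖ then
          ‖(((Φ N).flow τ z) i).2‖ ^ 4 else 0) ∂μ) := le_rfl
  -- (2) QMF₄ in collision-sum form (bridge on the good set: pre-velocity cut-off, post-velocity marks)
  have hP : ENNReal.ofReal (c * (σ ^ 2 * ((N : ℝ) + 1) ^ ((1 : ℝ) / 3))) *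
      (∫⁻ τ in Set.Ioc s s', (∫⁻ z, ENNReal.ofReal (((N : ℝ) + 1)⁻¹ *
        ∑ i : Fin (N + 1), if K₀ < ‖(((Φ N).flow τ z) i).2‖ then
          ‖(((Φ N).flow τ z) i).2‖ ^ 4 else 0) ∂μ)) ≤
      ∫⁻ z, ENNReal.ofReal ((Φ N).collisionSum (Set.Ioc s s')
        (fun col => if K₀ < ‖col.preVel.1‖ then
          ((N : ℝ) + 1)⁻¹ * (2 * (‖col.postVel.1‖ ^ 2 * ‖col.postVel.2‖ ^ 2)) else 0) z) ∂μ := by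
    refine key₁.trans_eq (lintegral_congr_ae ?_)
    filter_upwards [hgood] with z hz
    exact c5lif2_bridge_mixpost_cutoff (Φ N) hz s s' K₀ _ hc'
  -- (3) dropping the cut-off record by record
  have hPQ : (∫⁻ z, ENNReal.ofReal ((Φ N).collisionSum (Set.Ioc s s')
        (fun col => if K₀ < ‖col.preVel.1‖ then
          ((N : ℝ) + 1)⁻¹ * (2 * (‖col.postVel.1‖ ^ 2 * ‖col.postVel.2‖ ^ 2)) else 0) z) ∂μ) ≤
      ∫⁻ z, ENNReal.ofReal ((Φ N).collisionSum (Set.Ioc s s')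
        (fun col => ((N : ℝ) + 1)⁻¹ * (2 * (‖col.postVel.1‖ ^ 2 * ‖col.postVel.2‖ ^ 2))) z) ∂μ := by
    refine lintegral_mono_ae ?_
    filter_upwards [hgood] with z hz
    exact ENNReal.ofReal_le_ofReal (c5lif2_cutoffMixSum_le_mixSum (Φ N) hz s s' K₀ hc')
  -- (4) the trivial step `ofReal 1 · Q ≤ Q` (no split-deficit detour)
  have hQR : ENNReal.ofReal 1 * (∫⁻ z, ENNReal.ofReal ((Φ N).collisionSum (Set.Ioc s s')
        (fun col => ((N : ℝ) + 1)⁻¹ * (2 * (‖col.postVel.1‖ ^ 2 * ‖col.postVel.2‖ ^ 2))) z) ∂μ) ≤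
      ∫⁻ z, ENNReal.ofReal ((Φ N).collisionSum (Set.Ioc s s')
        (fun col => ((N : ℝ) + 1)⁻¹ * (2 * (‖col.postVel.1‖ ^ 2 * ‖col.postVel.2‖ ^ 2))) z) ∂μ := by
    rw [ENNReal.ofReal_one, one_mul]
  -- (5) `2mix⁺ ≤ 2(Δ₄)₋/2 + 2mix⁻` record by record, integrated (the flux integrand is a.e.-measurable)
  have hR : (∫⁻ z, ENNReal.ofReal ((Φ N).collisionSum (Set.Ioc s s')
        (fun col => ((N : ℝ) + 1)⁻¹ * (2 * (‖col.postVel.1‖ ^ 2 * ‖col.postVel.2‖ ^ 2))) z)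
        ∂μ) ≤
      2 * (∫⁻ z, ENNReal.ofReal (((N : ℝ) + 1)⁻¹ *
          (Φ N).collisionSum (Set.Ioc s s')
            (fun col => max (‖col.preVel.1‖ ^ 4 + ‖col.preVel.2‖ ^ 4
              - ‖col.postVel.1‖ ^ 4 - ‖col.postVel.2‖ ^ 4) 0 / 2) z) ∂μ) +
      2 * (∫⁻ z, ENNReal.ofReal (((N : ℝ) + 1)⁻¹ *
          (Φ N).collisionSum (Set.Ioc s s')
            (fun col => ‖col.preVel.1‖ ^ 2 * ‖col.preVel.2‖ ^ 2) z) ∂μ) := by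
    rw [← lintegral_const_mul' _ _ (ENNReal.ofNat_ne_top : (2 : ℝ≥0∞) ≠ ∞),
      ← lintegral_const_mul' _ _ (ENNReal.ofNat_ne_top : (2 : ℝ≥0∞) ≠ ∞),
      ← lintegral_add_right' _
        ((((c5lif_aemeasurable_fluxSum hε (Φ N) s s' hgood).const_mul _).ennreal_ofReal).const_mul _)]
    refine lintegral_mono_ae ?_
    filter_upwards [hgood] with z hz
    exact c5lif_ofReal_mixpostSum_le (Φ N) hz s s' hc'
  -- (6) assemble with S2a″
  have key := c5lif_assembly zero_le_one h5 hP hPQ hQR hR key₃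
  rw [one_mul] at key
  exact key

end Summit.AtomisticToContinuum.HydrodynamicLimit.Theorems.QuarticSchurLedger

end
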